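import Summits.AtomisticToContinuum.HydrodynamicLimit.Theorems.JParityClosureLocalSecondLawLedgerHonestA
import Summits.AtomisticToContinuum.HydrodynamicLimit.Theorems.JParityClosureLocalSecondLawLedgerIBP
import Summits.AtomisticToContinuum.HydrodynamicLimit.Theorems.LocalSecondLaw.Negative.LinearMajorant

/-!
# Entropy ledger for `JParityClosure.LocalSecondLaw` — honesty of the time integrals on the regular event
(stmt-AtomisticToContinuum-13081, line `exact-entropy-ledger-three-passivities`, layer 12 of stub L)

On the regular event the four inner (space) integrals of the ledger — the integrand of the crux functional
`entropyFunctional` and those of `T₁`, `T₂smooth`, `T₃kin` — are, as functions of time, measurable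
(through their continuous twins along the measurable orbit, `measurable_flow_section`) and bounded on
`[0, τ]` (uniform bounds of layer 11 on the bounded-velocity box, which contains the orbit by energy
conservation).  Hence they are integrable on `[0, τ]`: every Bochner integral in the statement of the ledger
is an honest integral on the regular event.

References: H. Federer, *Geometric Measure Theory* (1969) 2.6.2 (Fubini–Tonelli, measurable sections).
-/

noncomputable section

namespace Summit.AtomisticToContinuum.HydrodynamicLimit.Theorems.LocalSecondLawLedger

open scoped BigOperators Topology ENNReal InnerProductSpace NNReal
open Filter Set MeasureTheory
open Literature.MathematicalPhysics.KineticTheory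
open Literature.Analysis.FluidPDE
open Literature.Analysis.FunctionSpaces
open Summit.AtomisticToContinuum.HydrodynamicLimit.Theorems.LocalSecondLawNegative

namespace L

variable {N : ℕ}

/-- A measurable function bounded on `[0, τ]` is integrable there. [folklore] -/
theorem integrableOn_Icc_of_bound {f : ℝ → ℝ} (hf : Measurable f) {τ C : ℝ} (h : ∀ s ∈ Set.Icc 0 τ, |f s| ≤ C) :
    IntegrableOn f (Set.Icc 0 τ) := by
  haveI : IsFiniteMeasure ((volume : Measure ℝ).restrict (Set.Icc (0 : ℝ) τ)) :=
    ⟨by rw [Measure.restrict_apply_univ]; exact measure_Icc_lt_top⟩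
  refine Integrable.mono' (integrable_const C) hf.aestronglyMeasurable ?_
  exact ae_restrict_of_forall_mem measurableSet_Icc fun s hs => by rw [Real.norm_eq_abs]; exact h s hs

/-! ## The twin integrands -/

/-- Twin of the integrand of the crux functional. [folklore] -/
def ETi (σ r c η₁ : ℝ) (φ : ℝ → T3 → ℝ) (s : ℝ) (w : Phase N) (x : T3) : ℝ :=
  HsT σ r c η₁ w x * (deriv (fun s' => φ s' x) s + ∑ k, momC r w x k / rhoT r c w x * pD k (φ s) x)

/-- Twin of the integrand of `T₁` (without the sign). [folklore] -/
def A1Ti (r c : ℝ) (φ : ℝ → T3 → ℝ) (s : ℝ) (w : Phase N) (x : T3) : ℝ :=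
  φ s x / thetaT r c w x * ∑ k, ∑ l, devT r c w x k l * pD k (fun y => uT r c w y l) x

/-- Twin of the integrand of `T₂smooth`. [folklore] -/
def A2Ti (σ r c η₁ : ℝ) (φ : ℝ → T3 → ℝ) (s : ℝ) (w : Phase N) (x : T3) : ℝ :=
  φ s x / thetaT r c w x * pexT σ r c η₁ w x * ∑ k, pD k (fun y => uT r c w y k) x

/-- Twin of the integrand of `T₃kin`. [folklore] -/
def A3Ti (r c : ℝ) (φ : ℝ → T3 → ℝ) (s : ℝ) (w : Phase N) (x : T3) : ℝ :=
  ∑ k, pD k (fun y => φ s y / thetaT r c w y) x * qT r c w x k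

section OnRegular

variable {σ r c η₁ : ℝ} {φ : ℝ → T3 → ℝ} (hc : 0 < c) {w : Phase N}
  (hreg : ∀ x, c ≤ rhoC r w x ∧ rhoC r w x * σ ^ 3 ≤ η₁ ∧ c ≤ thetaC r w x)
include hreg

include hc in
/-- On the regular range the twin of the crux integrand is the crux integrand. [folklore] -/
theorem ETi_eq (s : ℝ) (x : T3) : ETi σ r c η₁ φ s w x =
    Hs σ (rhoC r w x) (thetaC r w x) * (deriv (fun s' => φ s' x) s + ∑ k, momC r w x k / rhoC r w x * pD k (φ s) x) := by
  rw [ETi, HsT_eq hc hreg, rhoT_eq hreg]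

/-- On the regular range the twin of the `T₁` integrand is the `T₁` integrand. [folklore] -/
theorem A1Ti_eq (s : ℝ) (x : T3) : A1Ti r c φ s w x =
    φ s x / thetaC r w x * ∑ k, ∑ l, devC r w x k l * pD k (fun y => uC r w y l) x := by
  simp only [A1Ti, thetaT_eq hreg, devT_eq hreg, uT_fun_eq hreg]

/-- On the regular range the twin of the `T₂smooth` integrand is the `T₂smooth` integrand. [folklore] -/
theorem A2Ti_eq (s : ℝ) (x : T3) : A2Ti σ r c η₁ φ s w x =
    φ s x / thetaC r w x * pexC σ r w x * ∑ k, pD k (fun y => uC r w y k) x := by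
  simp only [A2Ti, thetaT_eq hreg, pexT_eq hreg, uT_fun_eq hreg]

/-- On the regular range the twin of the `T₃kin` integrand is the `T₃kin` integrand. [folklore] -/
theorem A3Ti_eq (s : ℝ) (x : T3) : A3Ti r c φ s w x =
    ∑ k, pD k (fun y => φ s y / thetaC r w y) x * qkinC r w x k := by
  simp only [A3Ti, thetaT_fun_eq hreg, qT_eq hreg]

end OnRegular

/-! ## Measurability along the orbit -/

section Measurable

variable {σ r c η₁ η₀ τ : ℝ} {F : ℝ → ℝ} (hE : EosBand η₀ F) (hη : 0 < η₁) (hη₁ : η₁ < η₀) (hσ : 0 < σ)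
  (hr : 0 < r) (hc : 0 < c) {φ : ℝ → T3 → ℝ} (hφ : Torus.IsSmoothSpaceTimeOn Set.univ φ)
  (Φ : Flow σ N) {z : Phase N} (hz : z ∈ Φ.good)

include hz in
/-- Pairing the orbit with the field point is measurable. [folklore] -/
theorem measurable_orbit_pair : Measurable fun q : ℝ × T3 => (Φ.flow q.1 z, q.2) :=
  ((measurable_flow_section Φ hz).comp measurable_fst).prodMk measurable_snd

include hφ in
/-- The partial derivatives of the test function are jointly continuous. [folklore] -/
theorem continuous_uncurry_pD_phi (k : Fin 3) : Continuous (Function.uncurry fun s x => pD k (φ s) x) :=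
  continuous_uncurry_of_smooth (hφ.partialDeriv uniqueDiffOn_univ k)

include hz in
/-- Lifting the time–space pair to the big parameter space along the orbit is measurable. [folklore] -/
theorem measurable_orbit_lift : Measurable fun p : ℝ × T3 => ((p.1, (Φ.flow p.1 z, p.2)) : ℝ × Phase N × T3) :=
  measurable_fst.prodMk (((measurable_flow_section Φ hz).comp measurable_fst).prodMk measurable_snd)

include hE hη hη₁ hσ hr hc hφ in
/-- The twin of the crux integrand is jointly measurable in (time, configuration, field point). [folklore] -/
theorem measurable_ETi_big : Measurable fun q : ℝ × Phase N × T3 => ETi σ r c η₁ φ q.1 q.2.1 q.2.2 := by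
  have h1 : Measurable fun q : ℝ × Phase N × T3 => HsT σ r c η₁ q.2.1 q.2.2 :=
    (continuous_HsT₂ hE hη hη₁ hσ hr hc).measurable.comp measurable_snd
  have h2 : Measurable fun q : ℝ × Phase N × T3 => deriv (fun s' => φ s' q.2.2) q.1 :=
    (continuous_uncurry_deriv_of_smooth hφ).measurable.comp (measurable_fst.prodMk (measurable_snd.comp measurable_snd))
  have h3 : ∀ k, Measurable fun q : ℝ × Phase N × T3 => momC r q.2.1 q.2.2 k := fun k =>
    (continuous_momC₂ hr k).measurable.comp measurable_snd
  have h4 : Measurable fun q : ℝ × Phase N × T3 => rhoT r c q.2.1 q.2.2 :=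
    (continuous_rhoT₂ hr (c := c)).measurable.comp measurable_snd
  have h5 : ∀ k, Measurable fun q : ℝ × Phase N × T3 => pD k (φ q.1) q.2.2 := fun k =>
    (continuous_uncurry_pD_phi hφ k).measurable.comp (measurable_fst.prodMk (measurable_snd.comp measurable_snd))
  unfold ETi
  exact h1.mul (h2.add (Finset.measurable_sum _ fun k _ => ((h3 k).div h4).mul (h5 k)))

include hr hc hφ in
/-- The twin of the `T₁` integrand is jointly measurable in (time, configuration, field point). [folklore] -/
theorem measurable_A1Ti_big : Measurable fun q : ℝ × Phase N × T3 => A1Ti r c φ q.1 q.2.1 q.2.2 := by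
  have hpd : ∀ k l : Fin 3, Measurable fun q : ℝ × Phase N × T3 => pD k (fun y => uT r c q.2.1 y l) q.2.2 := fun k l =>
    (measurable_pD_param (α := Phase N) (g := fun w y => uT r c w y l) (continuous_uT₂ hr hc l) k).comp measurable_snd
  have h1 : Measurable fun q : ℝ × Phase N × T3 => φ q.1 q.2.2 :=
    (continuous_uncurry_of_smooth hφ).measurable.comp (measurable_fst.prodMk (measurable_snd.comp measurable_snd))
  have h2 : Measurable fun q : ℝ × Phase N × T3 => thetaT r c q.2.1 q.2.2 :=
    (continuous_thetaT₂ hr hc).measurable.comp measurable_snd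
  have h3 : ∀ k l, Measurable fun q : ℝ × Phase N × T3 => devT r c q.2.1 q.2.2 k l := fun k l =>
    (continuous_devT₂ hr hc k l).measurable.comp measurable_snd
  unfold A1Ti
  exact (h1.div h2).mul (Finset.measurable_sum _ fun k _ => Finset.measurable_sum _ fun l _ => (h3 k l).mul (hpd k l))

include hE hη hη₁ hσ hr hc hφ in
/-- The twin of the `T₂smooth` integrand is jointly measurable in (time, configuration, field point). [folklore] -/
theorem measurable_A2Ti_big : Measurable fun q : ℝ × Phase N × T3 => A2Ti σ r c η₁ φ q.1 q.2.1 q.2.2 := by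
  have hpd : ∀ k : Fin 3, Measurable fun q : ℝ × Phase N × T3 => pD k (fun y => uT r c q.2.1 y k) q.2.2 := fun k =>
    (measurable_pD_param (α := Phase N) (g := fun w y => uT r c w y k) (continuous_uT₂ hr hc k) k).comp measurable_snd
  have h1 : Measurable fun q : ℝ × Phase N × T3 => φ q.1 q.2.2 :=
    (continuous_uncurry_of_smooth hφ).measurable.comp (measurable_fst.prodMk (measurable_snd.comp measurable_snd))
  have h2 : Measurable fun q : ℝ × Phase N × T3 => thetaT r c q.2.1 q.2.2 :=
    (continuous_thetaT₂ hr hc).measurable.comp measurable_snd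
  have h3 : Measurable fun q : ℝ × Phase N × T3 => pexT σ r c η₁ q.2.1 q.2.2 :=
    (continuous_pexT₂ hE hη hη₁ hσ hr hc).measurable.comp measurable_snd
  unfold A2Ti
  exact ((h1.div h2).mul h3).mul (Finset.measurable_sum _ fun k _ => hpd k)

/-- Two-parameter version of the measurability of the crux's partial derivatives. [folklore] -/
theorem measurable_pD_param₂ {α β : Type*} [TopologicalSpace α] [MeasurableSpace α] [OpensMeasurableSpace α]
    [TopologicalSpace β] [MeasurableSpace β] [OpensMeasurableSpace β] [SecondCountableTopology α]
    [SecondCountableTopology β] {g : α → β → T3 → ℝ}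
    (hg : Continuous fun p : α × β × T3 => g p.1 p.2.1 p.2.2) (k : Fin 3) :
    Measurable fun p : α × β × T3 => pD k (g p.1 p.2.1) p.2.2 := by
  have hc : Continuous (Function.uncurry fun (q : α × β × T3) (t : ℝ) =>
      g q.1 q.2.1 (q.2.2 + Torus.proj (t • EuclideanSpace.single k 1))) :=
    hg.comp ((continuous_fst.comp continuous_fst).prodMk (((continuous_fst.comp continuous_snd).comp continuous_fst).prodMk
      (((continuous_snd.comp continuous_snd).comp continuous_fst).add
        (Torus.continuous_proj.comp (continuous_snd.smul continuous_const)))))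
  exact (measurable_deriv_with_param hc).comp (measurable_id.prodMk measurable_const)

include hr hc hφ in
/-- The twin of the `T₃kin` integrand is jointly measurable in (time, configuration, field point). [folklore] -/
theorem measurable_A3Ti_big : Measurable fun q : ℝ × Phase N × T3 => A3Ti r c φ q.1 q.2.1 q.2.2 := by
  have h1 : Continuous fun q : ℝ × Phase N × T3 => φ q.1 q.2.2 :=
    (continuous_uncurry_of_smooth hφ).comp (continuous_fst.prodMk (continuous_snd.comp continuous_snd))
  have h2 : Continuous fun q : ℝ × Phase N × T3 => thetaT r c q.2.1 q.2.2 :=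
    (continuous_thetaT₂ hr hc).comp continuous_snd
  have hg : Continuous fun q : ℝ × Phase N × T3 => φ q.1 q.2.2 / thetaT r c q.2.1 q.2.2 :=
    h1.div h2 fun q => (thetaT_pos hc _ _).ne'
  have hpd : ∀ k : Fin 3, Measurable fun q : ℝ × Phase N × T3 => pD k (fun y => φ q.1 y / thetaT r c q.2.1 y) q.2.2 :=
    fun k => measurable_pD_param₂ (g := fun s w y => φ s y / thetaT r c w y) hg k
  have h3 : ∀ k, Measurable fun q : ℝ × Phase N × T3 => qT r c q.2.1 q.2.2 k := fun k =>
    (continuous_qT₂ hr hc k).measurable.comp measurable_snd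
  unfold A3Ti
  exact Finset.measurable_sum _ fun k _ => (hpd k).mul (h3 k)

include hE hη hη₁ hσ hr hc hφ hz in
/-- The twin integrand of the crux functional is jointly measurable along the orbit. [folklore] -/
theorem measurable_ETi_orbit :
    Measurable ((fun q : ℝ × Phase N × T3 => ETi σ r c η₁ φ q.1 q.2.1 q.2.2) ∘
      fun p : ℝ × T3 => ((p.1, (Φ.flow p.1 z, p.2)) : ℝ × Phase N × T3)) :=
  (measurable_ETi_big hE hη hη₁ hσ hr hc hφ).comp (measurable_orbit_lift Φ hz)

include hr hc hφ hz in
/-- The twin integrand of `T₁` is jointly measurable along the orbit. [folklore] -/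
theorem measurable_A1Ti_orbit :
    Measurable ((fun q : ℝ × Phase N × T3 => A1Ti r c φ q.1 q.2.1 q.2.2) ∘
      fun p : ℝ × T3 => ((p.1, (Φ.flow p.1 z, p.2)) : ℝ × Phase N × T3)) :=
  (measurable_A1Ti_big hr hc hφ).comp (measurable_orbit_lift Φ hz)

include hE hη hη₁ hσ hr hc hφ hz in
/-- The twin integrand of `T₂smooth` is jointly measurable along the orbit. [folklore] -/
theorem measurable_A2Ti_orbit :
    Measurable ((fun q : ℝ × Phase N × T3 => A2Ti σ r c η₁ φ q.1 q.2.1 q.2.2) ∘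
      fun p : ℝ × T3 => ((p.1, (Φ.flow p.1 z, p.2)) : ℝ × Phase N × T3)) :=
  (measurable_A2Ti_big hE hη hη₁ hσ hr hc hφ).comp (measurable_orbit_lift Φ hz)

include hr hc hφ hz in
/-- The twin integrand of `T₃kin` is jointly measurable along the orbit. [folklore] -/
theorem measurable_A3Ti_orbit :
    Measurable ((fun q : ℝ × Phase N × T3 => A3Ti r c φ q.1 q.2.1 q.2.2) ∘
      fun p : ℝ × T3 => ((p.1, (Φ.flow p.1 z, p.2)) : ℝ × Phase N × T3)) :=
  (measurable_A3Ti_big hr hc hφ).comp (measurable_orbit_lift Φ hz)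

end Measurable

/-! ## Integrability of the four inner integrals on `[0, τ]` -/

section Honest

variable {σ r c η₁ η₀ τ : ℝ} {F : ℝ → ℝ} (hE : EosBand η₀ F) (hη : 0 < η₁) (hη₁ : η₁ < η₀) (hσ : 0 < σ)
  (hr : 0 < r) (hc : 0 < c) {φ : ℝ → T3 → ℝ} (hφ : Torus.IsSmoothSpaceTimeOn Set.univ φ)
  (Φ : Flow σ N) {z : Phase N} (hR : Regular σ r τ c η₁ Φ z)
include hE hη hη₁ hσ hr hc hφ hR

omit hE hη hη₁ hσ hr hc hφ hR in
/-- Template: a twin integrand, jointly measurable along the orbit and uniformly bounded on `[0, τ]`, which agrees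
with the true integrand on the regular event, has an inner integral integrable on `[0, τ]`. [folklore] -/
theorem integrableOn_of_twin {XT : ℝ → Phase N → T3 → ℝ} {X : ℝ → T3 → ℝ}
    (hm : Measurable ((fun q : ℝ × Phase N × T3 => XT q.1 q.2.1 q.2.2) ∘
      fun p : ℝ × T3 => ((p.1, (Φ.flow p.1 z, p.2)) : ℝ × Phase N × T3)))
    {C : ℝ} (hb : ∀ s ∈ Set.Icc 0 τ, ∀ x, |XT s (Φ.flow s z) x| ≤ C)
    (heq : ∀ s ∈ Set.Icc 0 τ, ∀ x, XT s (Φ.flow s z) x = X s x) :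
    IntegrableOn (fun s => ∫ x, X s x) (Set.Icc 0 τ) := by
  have hSM := MeasureTheory.StronglyMeasurable.integral_prod_right' (ν := (volume : Measure T3)) hm.stronglyMeasurable
  have hval : ∀ s x, ((fun q : ℝ × Phase N × T3 => XT q.1 q.2.1 q.2.2) ∘
      fun p : ℝ × T3 => ((p.1, (Φ.flow p.1 z, p.2)) : ℝ × Phase N × T3)) (s, x) = XT s (Φ.flow s z) x := fun s x => rfl
  simp only [hval] at hSM
  have hI : IntegrableOn (fun s => ∫ x, XT s (Φ.flow s z) x) (Set.Icc 0 τ) :=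
    integrableOn_Icc_of_bound hSM.measurable fun s hs => by
      -- on the probability space `𝕋³` a pointwise bound bounds the integral
      have h1 := norm_integral_le_of_norm_le_const (μ := (volume : Measure T3)) (f := fun x => XT s (Φ.flow s z) x)
        (C := C) (Filter.Eventually.of_forall fun x => by rw [Real.norm_eq_abs]; exact hb s hs x)
      simpa [Real.norm_eq_abs] using h1
  exact hI.congr_fun (fun s hs => integral_congr_ae (Filter.Eventually.of_forall (heq s hs))) measurableSet_Icc

omit hE hη hη₁ hσ in
/-- **The inner integral of `T₁` is integrable on `[0, τ]` on the regular event.** [folklore] -/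
theorem integrableOn_innerT₁ :
    IntegrableOn (fun s => ∫ x, φ s x / thetaC r (Φ.flow s z) x *
      ∑ k, ∑ l, devC r (Φ.flow s z) x k l * pD k (fun y => uC r (Φ.flow s z) y l) x) (Set.Icc 0 τ) := by
  set V : ℝ := Real.sqrt (2 * configEnergy z) with hV
  have hV0 : 0 ≤ V := Real.sqrt_nonneg _
  have hKV : ∀ s, Φ.flow s z ∈ KV N V := fun s => flow_mem_KV Φ hR.1 s
  obtain ⟨A, Kφ, hAK⟩ := testFunction_box hφ τ
  have hD := fun k l => exists_bound_on_KV (G := fun p : Phase N × T3 => devT r c p.1 p.2 k l) (continuous_devT₂ hr hc k l) V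
  choose D hD using hD
  refine integrableOn_of_twin Φ (XT := A1Ti r c φ) (measurable_A1Ti_orbit hr hc hφ Φ hR.1)
    (C := (A : ℝ) * c⁻¹ * ∑ k, ∑ l, D k l * (KuBox r c V : ℝ)) (fun s hs x => ?_) (fun s hs x => A1Ti_eq (hR.2 s hs) s x)
  obtain ⟨hA, -, -, -⟩ := hAK s hs
  unfold A1Ti
  rw [abs_mul]
  refine mul_le_mul ?_ ((Finset.abs_sum_le_sum_abs _ _).trans (Finset.sum_le_sum fun k _ =>
    (Finset.abs_sum_le_sum_abs _ _).trans (Finset.sum_le_sum fun l _ => ?_))) (abs_nonneg _) (by positivity)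
  · rw [abs_div]
    rw [div_eq_mul_inv]
    refine mul_le_mul (hA x) ?_ (by positivity) A.2
    rw [abs_of_pos (thetaT_pos hc _ _)]
    exact inv_anti₀ hc (le_max_right _ _)
  · rw [abs_mul]
    exact mul_le_mul (hD k l _ (hKV s) x) (abs_pD_le (lipschitzWith_uT_box hr hc hV0 (hKV s) l) k x) (abs_nonneg _)
      ((abs_nonneg _).trans (hD k l _ (hKV s) x))

/-- **The inner integral of `T₂smooth` is integrable on `[0, τ]` on the regular event.** [folklore] -/
theorem integrableOn_innerT₂ :
    IntegrableOn (fun s => ∫ x, φ s x / thetaC r (Φ.flow s z) x * pexC σ r (Φ.flow s z) x *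
      ∑ k, pD k (fun y => uC r (Φ.flow s z) y k) x) (Set.Icc 0 τ) := by
  set V : ℝ := Real.sqrt (2 * configEnergy z) with hV
  have hV0 : 0 ≤ V := Real.sqrt_nonneg _
  have hKV : ∀ s, Φ.flow s z ∈ KV N V := fun s => flow_mem_KV Φ hR.1 s
  obtain ⟨A, Kφ, hAK⟩ := testFunction_box hφ τ
  obtain ⟨P, hP⟩ := exists_bound_on_KV (G := fun p : Phase N × T3 => pexT σ r c η₁ p.1 p.2) (continuous_pexT₂ hE hη hη₁ hσ hr hc) V
  refine integrableOn_of_twin Φ (XT := A2Ti σ r c η₁ φ)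
    (measurable_A2Ti_orbit hE hη hη₁ hσ hr hc hφ Φ hR.1)
    (C := (A : ℝ) * c⁻¹ * P * ∑ _k : Fin 3, (KuBox r c V : ℝ)) (fun s hs x => ?_) (fun s hs x => A2Ti_eq (hR.2 s hs) s x)
  obtain ⟨hA, -, -, -⟩ := hAK s hs
  have hP0 : 0 ≤ P := (abs_nonneg _).trans (hP _ (hKV s) x)
  unfold A2Ti
  rw [abs_mul, abs_mul]
  refine mul_le_mul (mul_le_mul ?_ (hP _ (hKV s) x) (abs_nonneg _) (by positivity))
    ((Finset.abs_sum_le_sum_abs _ _).trans (Finset.sum_le_sum fun k _ =>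
      abs_pD_le (lipschitzWith_uT_box hr hc hV0 (hKV s) k) k x)) (abs_nonneg _) (by positivity)
  rw [abs_div, div_eq_mul_inv]
  refine mul_le_mul (hA x) ?_ (by positivity) A.2
  rw [abs_of_pos (thetaT_pos hc _ _)]
  exact inv_anti₀ hc (le_max_right _ _)

omit hE hη hη₁ hσ in
/-- **The inner integral of `T₃kin` is integrable on `[0, τ]` on the regular event.** [folklore] -/
theorem integrableOn_innerT₃ :
    IntegrableOn (fun s => ∫ x, ∑ k, pD k (fun y => φ s y / thetaC r (Φ.flow s z) y) x * qkinC r (Φ.flow s z) x k)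
      (Set.Icc 0 τ) := by
  set V : ℝ := Real.sqrt (2 * configEnergy z) with hV
  have hV0 : 0 ≤ V := Real.sqrt_nonneg _
  have hKV : ∀ s, Φ.flow s z ∈ KV N V := fun s => flow_mem_KV Φ hR.1 s
  obtain ⟨K, hK⟩ := exists_lipschitz_phi_div_thetaT_box hr hc hV0 hφ τ (N := N)
  have hQ := fun k => exists_bound_on_KV (G := fun p : Phase N × T3 => qT r c p.1 p.2 k) (continuous_qT₂ hr hc k) V
  choose Q hQ using hQ
  refine integrableOn_of_twin Φ (XT := A3Ti r c φ) (measurable_A3Ti_orbit hr hc hφ Φ hR.1)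
    (C := ∑ k, (K : ℝ) * Q k) (fun s hs x => ?_) (fun s hs x => A3Ti_eq (hR.2 s hs) s x)
  unfold A3Ti
  refine (Finset.abs_sum_le_sum_abs _ _).trans (Finset.sum_le_sum fun k _ => ?_)
  rw [abs_mul]
  exact mul_le_mul (abs_pD_le (hK s hs _ (hKV s)) k x) (hQ k _ (hKV s) x) (abs_nonneg _) K.2

/-- **The inner integral of the crux functional is integrable on `[0, τ]` on the regular event.** [folklore] -/
theorem integrableOn_innerE :
    IntegrableOn (fun s => ∫ x, Hs σ (rhoC r (Φ.flow s z) x) (thetaC r (Φ.flow s z) x) *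
      (deriv (fun s' => φ s' x) s + ∑ k, momC r (Φ.flow s z) x k / rhoC r (Φ.flow s z) x * pD k (φ s) x))
      (Set.Icc 0 τ) := by
  set V : ℝ := Real.sqrt (2 * configEnergy z) with hV
  have hV0 : 0 ≤ V := Real.sqrt_nonneg _
  have hKV : ∀ s, Φ.flow s z ∈ KV N V := fun s => flow_mem_KV Φ hR.1 s
  obtain ⟨A, Kφ, hAK⟩ := testFunction_box hφ τ
  obtain ⟨H, hH⟩ := exists_bound_on_KV (G := fun p : Phase N × T3 => HsT σ r c η₁ p.1 p.2) (continuous_HsT₂ hE hη hη₁ hσ hr hc) V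
  refine integrableOn_of_twin Φ (XT := ETi σ r c η₁ φ)
    (measurable_ETi_orbit hE hη hη₁ hσ hr hc hφ Φ hR.1)
    (C := H * ((A : ℝ) + ∑ _k : Fin 3, 3 / (Real.pi * r ^ 3) * V * c⁻¹ * (A : ℝ))) (fun s hs x => ?_)
    (fun s hs x => ETi_eq hc (hR.2 s hs) s x)
  obtain ⟨-, hAt, hAk, -⟩ := hAK s hs
  have hH0 : 0 ≤ H := (abs_nonneg _).trans (hH _ (hKV s) x)
  unfold ETi
  rw [abs_mul]
  refine mul_le_mul (hH _ (hKV s) x) ((abs_add_le _ _).trans (add_le_add (hAt x)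
    ((Finset.abs_sum_le_sum_abs _ _).trans (Finset.sum_le_sum fun k _ => ?_)))) (abs_nonneg _) hH0
  rw [abs_mul, abs_div, div_eq_mul_inv]
  have h1 : |rhoT r c (Φ.flow s z) x|⁻¹ ≤ c⁻¹ := by
    rw [abs_of_pos (rhoT_pos hc _ _)]; exact inv_anti₀ hc (le_max_right _ _)
  exact mul_le_mul (mul_le_mul (abs_momC_le_box hr (hKV s) x k) h1 (inv_nonneg.2 (abs_nonneg _)) (by positivity))
    (hAk k x) (abs_nonneg _) (by positivity)

end Honest

end L

/-- **Registered sub-goal `ledgerL_honestB`** of stub `stub_ledger` (line `exact-entropy-ledger-three-passivities`):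
Honesty of the time integral of the kinetic heat-current pairing on the regular event. [folklore] -/
theorem ledgerL_honestB :
  ∀ {N : ℕ} {σ r c η₁ τ : ℝ}, 0 < r → 0 < c → ∀ {φ : ℝ → T3 → ℝ}, Literature.Analysis.FunctionSpaces.Torus.IsSmoothSpaceTimeOn Set.univ φ → ∀ (Φ : Flow σ N) {z : Phase N}, Regular σ r τ c η₁ Φ z → MeasureTheory.IntegrableOn (fun s => ∫ x, ∑ k : Fin 3, pD k (fun y => φ s y / thetaC r (Φ.flow s z) y) x * qkinC r (Φ.flow s z) x k) (Set.Icc 0 τ) := by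
  intro N σ r c η₁ τ hr hc φ hφ Φ z hR
  exact L.integrableOn_innerT₃ hr hc hφ Φ hR

end Summit.AtomisticToContinuum.HydrodynamicLimit.Theorems.LocalSecondLawLedger

end
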